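import Summits.BirchSwinnertonDyer.BirchSwinnertonDyer.Theorems.ThetaPartnerAtTwoSignedMainConjectureCMTwoRankZeroFlatTwistFamilyDecomposition
import Summits.BirchSwinnertonDyer.Rank1Residual.X12.CMDeuringTwo
import HarnessLib

/-!
# Route `ThetaPartnerAtTwo`, crux K2r0P `SignedMainConjectureCMTwoRankZeroOfPub` (stmt-BirchSwinnertonDyer-24945),
# line `rankzero` v15, stub (μ♭)_A: the slice `j ∈ {1728, −3375, 8000, 54000, 287496, 16581375}` is VACUOUS

Cell `bsd-wall`, width seat `bsd-wall-tp2-p2-w4` (g8). THEOREMS ONLY (no `def`, no named fact, no `sorry`); helper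
`--supports` the crux; sequel of `…FlatTwistFamilyDecomposition` (namespace `…Theorems.FlatTwist.Family`), whose
`analyticMuFlat_of_tail_of_families` reads the registered stub `stub_analyticMuFlatNonUnitCMTwo` (= FLAT,
`AnalyticMuFlatCMTwoRankZero`, stmt-BirchSwinnertonDyer-26470) as «(T) the `j = 0` tail ∧ (V) the slice over
`{1728, −3375, 8000, 54000, 287496, 16581375}` ∧ (F) six family slices» and left the vacuity of (V) unproved.

Here (V) is discharged from the tree's kernel form of «supersingular at `2`» (cell `b2b-bsdres`, files
`Summits/BirchSwinnertonDyer/Rank1Residual/X12/SupersingularTwo.lean` and `…/CMDeuringTwo.lean`, CITED, not restated):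
for a globally minimal `A/ℚ` good at `2`, `GoodSS A 2 ↔ Even (num j(A))` (`X12.goodSS_two_iff_even_num_j`: over `𝔽₂`,
supersingular iff `ã₁ = 0`, Silverman *AEC* App. A Prop. 1.1(c)) and `num j(A)` is odd or divisible by `2¹²`
(`X12.odd_num_j_or_two_pow_twelve_dvd_of_good_two`: `2 ∣ a₁ ⟹ 16 ∣ c₄`, `j·Δ_min = c₄³`, `Δ_min` odd). The six listed
`j` are integers with `v₂ ∈ {6, 0, 6, 4, 3, 0}` — even but not divisible by `2¹²`, or odd — so none occurs:

* §1 `j_not_mem_of_goodSS_two` — `GoodSS A 2 ⟹ j(A) ∉ {1728, −3375, 8000, 54000, 287496, 16581375}` (no CM hypothesis);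
  `analyticMuFlat_vacuousSlice` — the binder `hV` of `analyticMuFlat_of_tail_of_families` holds VACUOUSLY;
* §2 `analyticMuFlat_of_tail_of_families'` — FLAT ⟸ (T) the `j = 0` tail ∧ (F) the six family slices (no (V) binder):
  the registered stub is, in the kernel, «`j = 0` tail ∧ six family slices», each family slice being the conclusion of a
  landed family node (`analyticMuFlat_family_of_pub`, `…_of_levelSixteen_siblings`, `…_of_unitZone_siblings_primePower`,
  `analyticMuFlat_of_j_eq_of_siblings`).

Nothing about any particular curve is asserted; the `j = 0` tail and the six family slices are NOT proved here; FLAT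
class-wide stays open; BSD is not proved by any of this.

References: Silverman *AEC* (2009) III.1 (`j = c₄³/Δ`), V Ex. 5.7, App. A Prop. 1.1(c) (characteristic `2`: `j = a₁¹²/Δ`,
supersingular iff `a₁ = 0`), VII.5 Prop. 5.1(a) [SilvermanAEC2009]; Silverman *ATAEC* (1994) App. A §3 (the thirteen CM
`j`-invariants) [SilvermanATAEC1994]; Lang, *Elliptic Functions* (1987) Ch. 13 §4 Thm. 12 [Lang1987].
-/

set_option autoImplicit false
-- the Theorems namespace of this sub repeats the summit name by design (D-0017 nested layout)
set_option linter.dupNamespace false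

noncomputable section

open scoped Classical MatrixGroups ModularForm NumberField NumberTheorySymbols

open NumberField IsDedekindDomain Rat.HeightOneSpectrum CongruenceSubgroup
  Literature.NumberTheory.EllipticCurves Literature.NumberTheory.GaloisRepresentations
  WeierstrassCurve Literature.NumberTheory.EllipticCurves.ModularForms Literature.NumberTheory.EllipticCurves.Rank1Residual
  Literature.NumberTheory.EllipticCurves.Rank1Residual.Typed
  Summit.BirchSwinnertonDyer.Rank1Residual Summit.BirchSwinnertonDyer.Rank1Residual.Supersingular

namespace Summit.BirchSwinnertonDyer.BirchSwinnertonDyer.Theorems.FlatTwist.Family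

/-! ## §1. Good supersingular at `2` excludes the six CM `j`-invariants of `2`-adic valuation `< 12` -/

/-- `q = z` for an integer `z` gives `num q = z`. [folklore] -/
private theorem num_eq_of_eq_intCast {q : ℚ} {z : ℤ} (h : q = (z : ℚ)) : q.num = z := by
  rw [h, Rat.num_intCast]

/-- **A globally minimal elliptic curve over `ℚ` with good supersingular reduction at `2` has
`j ∉ {1728, −3375, 8000, 54000, 287496, 16581375}`.** By the tree's `X12.goodSS_two_iff_even_num_j` (`GoodSS A 2` iff
good at `2` and `num j(A)` even — over `𝔽₂`, supersingular iff `ã₁ = 0`) and `X12.odd_num_j_or_two_pow_twelve_dvd_of_good_two`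
(at a good `2`, `num j(A)` is odd or divisible by `2¹²`: `2 ∣ a₁ ⟹ 16 ∣ c₄`, `j·Δ_min = c₄³`, `Δ_min` odd): the six integers
have `2`-adic valuation `6, 0, 6, 4, 3, 0`. These are the CM `j`-invariants of discriminants `−4, −7, −8, −12, −16, −28`
(Silverman *ATAEC* App. A §3); no CM hypothesis is used. [cite: SilvermanAEC2009, App. A Prop. 1.1(c), V Ex. 5.7 and VII.5 Prop. 5.1(a)]
[cite: SilvermanATAEC1994, App. A §3] -/
theorem j_not_mem_of_goodSS_two (A : WeierstrassCurve ℚ) [A.IsElliptic] [A.IsGloballyMinimal] (hss : GoodSS A 2) :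
    A.j ∉ ({1728, -3375, 8000, 54000, 287496, 16581375} : Finset ℚ) := by
  have h12 := X12.odd_num_j_or_two_pow_twelve_dvd_of_good_two A hss.1
  have heven := ((X12.goodSS_two_iff_even_num_j A).mp hss).2
  simp only [Finset.mem_insert, Finset.mem_singleton, not_or]
  refine ⟨?_, ?_, ?_, ?_, ?_, ?_⟩ <;> intro hj
  · rw [num_eq_of_eq_intCast (z := 1728) (by rw [hj]; norm_num)] at h12; revert h12; decide
  · rw [num_eq_of_eq_intCast (z := -3375) (by rw [hj]; norm_num)] at heven; revert heven; decide
  · rw [num_eq_of_eq_intCast (z := 8000) (by rw [hj]; norm_num)] at h12; revert h12; decide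
  · rw [num_eq_of_eq_intCast (z := 54000) (by rw [hj]; norm_num)] at h12; revert h12; decide
  · rw [num_eq_of_eq_intCast (z := 287496) (by rw [hj]; norm_num)] at h12; revert h12; decide
  · rw [num_eq_of_eq_intCast (z := 16581375) (by rw [hj]; norm_num)] at heven; revert heven; decide

/-- **The (V) slice of the stub is VACUOUS.** The binder `hV` of `analyticMuFlat_of_tail_of_families` — the registered stub
`stub_analyticMuFlatNonUnitCMTwo` restricted to `A.j ∈ {1728, −3375, 8000, 54000, 287496, 16581375}` — holds, because no
globally minimal curve good supersingular at `2` (`GoodSS A 2`) has such a `j`-invariant (`j_not_mem_of_goodSS_two`). Only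
`GoodSS A 2` and the `j`-constraint are used; nothing about CM, ranks, Ш, newforms or `p`-adic `L`-functions is asserted.
[cite: SilvermanAEC2009, App. A Prop. 1.1(c) and VII.5 Prop. 5.1(a)] -/
theorem analyticMuFlat_vacuousSlice :
    ∀ (A : WeierstrassCurve ℚ) [A.IsElliptic] [A.IsGloballyMinimal],
      A.j ∈ ({1728, -3375, 8000, 54000, 287496, 16581375} : Finset ℚ) → A.HasCM → A.analyticRank = 0 →
      GoodSS A 2 → A.frobeniusTrace 2 = 0 → 2 ∣ A.shaOrder * A.tamagawaProduct →
      ∀ [NeZero (A.conductorNorm ℤ)] (f : CuspForm (Gamma0 (A.conductorNorm ℤ)) 2), IsNewformOf A f →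
        ∀ (Lplus Lminus : IwasawaAlgebra 2), IsPollackPair f 2 Lplus Lminus →
          ∃ n : ℕ, IsUnit (PowerSeries.coeff n (kobayashiL 1 Lplus Lminus)) := by
  intro A _ _ hj _ _ hss _ _ _ _ _ _ _ _
  exact absurd hj (j_not_mem_of_goodSS_two A hss)

/-! ## §2. FLAT ⟸ the `j = 0` tail ∧ the six family slices -/

/-- **FLAT ⟸ TAIL ∧ SIX FAMILY SLICES** (the decomposition `analyticMuFlat_of_tail_of_families` with its vacuous binder (V)
discharged by `analyticMuFlat_vacuousSlice`): the registered stub `stub_analyticMuFlatNonUnitCMTwo` (= FLAT) follows from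
(T) its `j = 0` slice (the tail `y² = x³ + k`, the class-wide research residue) and (F) its six family slices
`j₀ ∈ {−12288000, −32768, −884736, −884736000, −147197952000, −262537412640768000}` (`27a`, `p = 11, 19, 43, 67, 163`), each the
conclusion of a family node of the `…FlatTwistFamily*` files. No slice is proved here; BSD is not proved by this.
[cite: SilvermanAEC2009, Appendix C §11] [cite: SilvermanATAEC1994, App. A §3] -/
theorem analyticMuFlat_of_tail_of_families'
    (hT : ∀ (A : WeierstrassCurve ℚ) [A.IsElliptic] [A.IsGloballyMinimal], A.j = 0 → A.HasCM → A.analyticRank = 0 →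
      GoodSS A 2 → A.frobeniusTrace 2 = 0 → 2 ∣ A.shaOrder * A.tamagawaProduct →
      ∀ [NeZero (A.conductorNorm ℤ)] (f : CuspForm (Gamma0 (A.conductorNorm ℤ)) 2), IsNewformOf A f →
        ∀ (Lplus Lminus : IwasawaAlgebra 2), IsPollackPair f 2 Lplus Lminus →
          ∃ n : ℕ, IsUnit (PowerSeries.coeff n (kobayashiL 1 Lplus Lminus)))
    (h27 : ∀ (A : WeierstrassCurve ℚ) [A.IsElliptic] [A.IsGloballyMinimal], A.j = -12288000 → A.HasCM → A.analyticRank = 0 →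
      GoodSS A 2 → A.frobeniusTrace 2 = 0 → 2 ∣ A.shaOrder * A.tamagawaProduct →
      ∀ [NeZero (A.conductorNorm ℤ)] (f : CuspForm (Gamma0 (A.conductorNorm ℤ)) 2), IsNewformOf A f →
        ∀ (Lplus Lminus : IwasawaAlgebra 2), IsPollackPair f 2 Lplus Lminus →
          ∃ n : ℕ, IsUnit (PowerSeries.coeff n (kobayashiL 1 Lplus Lminus)))
    (h11 : ∀ (A : WeierstrassCurve ℚ) [A.IsElliptic] [A.IsGloballyMinimal], A.j = -32768 → A.HasCM → A.analyticRank = 0 →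
      GoodSS A 2 → A.frobeniusTrace 2 = 0 → 2 ∣ A.shaOrder * A.tamagawaProduct →
      ∀ [NeZero (A.conductorNorm ℤ)] (f : CuspForm (Gamma0 (A.conductorNorm ℤ)) 2), IsNewformOf A f →
        ∀ (Lplus Lminus : IwasawaAlgebra 2), IsPollackPair f 2 Lplus Lminus →
          ∃ n : ℕ, IsUnit (PowerSeries.coeff n (kobayashiL 1 Lplus Lminus)))
    (h19 : ∀ (A : WeierstrassCurve ℚ) [A.IsElliptic] [A.IsGloballyMinimal], A.j = -884736 → A.HasCM → A.analyticRank = 0 →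
      GoodSS A 2 → A.frobeniusTrace 2 = 0 → 2 ∣ A.shaOrder * A.tamagawaProduct →
      ∀ [NeZero (A.conductorNorm ℤ)] (f : CuspForm (Gamma0 (A.conductorNorm ℤ)) 2), IsNewformOf A f →
        ∀ (Lplus Lminus : IwasawaAlgebra 2), IsPollackPair f 2 Lplus Lminus →
          ∃ n : ℕ, IsUnit (PowerSeries.coeff n (kobayashiL 1 Lplus Lminus)))
    (h43 : ∀ (A : WeierstrassCurve ℚ) [A.IsElliptic] [A.IsGloballyMinimal], A.j = -884736000 → A.HasCM → A.analyticRank = 0 →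
      GoodSS A 2 → A.frobeniusTrace 2 = 0 → 2 ∣ A.shaOrder * A.tamagawaProduct →
      ∀ [NeZero (A.conductorNorm ℤ)] (f : CuspForm (Gamma0 (A.conductorNorm ℤ)) 2), IsNewformOf A f →
        ∀ (Lplus Lminus : IwasawaAlgebra 2), IsPollackPair f 2 Lplus Lminus →
          ∃ n : ℕ, IsUnit (PowerSeries.coeff n (kobayashiL 1 Lplus Lminus)))
    (h67 : ∀ (A : WeierstrassCurve ℚ) [A.IsElliptic] [A.IsGloballyMinimal], A.j = -147197952000 → A.HasCM → A.analyticRank = 0 →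
      GoodSS A 2 → A.frobeniusTrace 2 = 0 → 2 ∣ A.shaOrder * A.tamagawaProduct →
      ∀ [NeZero (A.conductorNorm ℤ)] (f : CuspForm (Gamma0 (A.conductorNorm ℤ)) 2), IsNewformOf A f →
        ∀ (Lplus Lminus : IwasawaAlgebra 2), IsPollackPair f 2 Lplus Lminus →
          ∃ n : ℕ, IsUnit (PowerSeries.coeff n (kobayashiL 1 Lplus Lminus)))
    (h163 : ∀ (A : WeierstrassCurve ℚ) [A.IsElliptic] [A.IsGloballyMinimal], A.j = -262537412640768000 → A.HasCM →
      A.analyticRank = 0 → GoodSS A 2 → A.frobeniusTrace 2 = 0 → 2 ∣ A.shaOrder * A.tamagawaProduct →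
      ∀ [NeZero (A.conductorNorm ℤ)] (f : CuspForm (Gamma0 (A.conductorNorm ℤ)) 2), IsNewformOf A f →
        ∀ (Lplus Lminus : IwasawaAlgebra 2), IsPollackPair f 2 Lplus Lminus →
          ∃ n : ℕ, IsUnit (PowerSeries.coeff n (kobayashiL 1 Lplus Lminus))) :
    ∀ (A : WeierstrassCurve ℚ) [A.IsElliptic] [A.IsGloballyMinimal], A.HasCM → A.analyticRank = 0 →
      GoodSS A 2 → A.frobeniusTrace 2 = 0 → 2 ∣ A.shaOrder * A.tamagawaProduct →
      ∀ [NeZero (A.conductorNorm ℤ)] (f : CuspForm (Gamma0 (A.conductorNorm ℤ)) 2), IsNewformOf A f →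
        ∀ (Lplus Lminus : IwasawaAlgebra 2), IsPollackPair f 2 Lplus Lminus →
          ∃ n : ℕ, IsUnit (PowerSeries.coeff n (kobayashiL 1 Lplus Lminus)) :=
  analyticMuFlat_of_tail_of_families hT analyticMuFlat_vacuousSlice h27 h11 h19 h43 h67 h163

end Summit.BirchSwinnertonDyer.BirchSwinnertonDyer.Theorems.FlatTwist.Family

end
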